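import Summits.AtomisticToContinuum.Crystallization.Theorems.SlackRigidity.Negative.WitnessBasics
import Literature.MathematicalPhysics.StatisticalMechanics.MuGroundStateConfiguration
import Literature.MathematicalPhysics.StatisticalMechanics.LocalMatchingCompactness

/-!
# drefute evidence for line `c-layer-witness-strictness` (crux `SlackRigidity`, stmt-AtomisticToContinuum-11960):
a sorry-free proof of `stub_localLimit` (the local limit is zero-slack and unmatched)

POSITIVE evidence (refuter seat `refuter-drefute-stmt-AtomisticToContinuum-11960-0`): the stub as registered is
TRUE; `stub_localLimit_proof` proves its statement verbatim.

Proof: the tree's sequential compactness `exists_subseq_forall_eventually_ballMatch` (δ = 1/3) gives `φ`, `Y`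
(`1/3`-separated) with `BallMatch η R' 0 (S (φ k)) Y` eventually for all `R', η > 0`; `0 ∈ Y` (partners of the
root accumulate at one point of norm `→ 0`); `U (dist y y') = 0` by continuity of `U` on `(0, ∞)` at the limit
distance (partners `s_k → y`, `s'_k → y'`, `U (dist s_k s'_k) ≤ η_k → 0`); `F`-tightness of every recentred
`ρ'`-star by the uniform-continuity clause applied to the recentred pair `(S (φ k) − s_k, Y − y)`, which is
`BallMatch (2η) (ρ'+1) 0`-close; and a root-matching of `Y` at `(R+1, ε/2)` would root-match `S (φ k)` at `(R, ε)`.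
-/

noncomputable section

namespace Summit.AtomisticToContinuum.Crystallization.Cruxes.SlackRigidity.DrefuteEvidence

open scoped Topology
open Filter Set Metric
open Literature.MathematicalPhysics.StatisticalMechanics
open Summit.AtomisticToContinuum.Crystallization.Theorems.SlackRigidityNegative (E3)

/-- Translation preserves `δ`-separation. [folklore] -/
theorem sep_translate {Y : Set E3} {δ : ℝ}
    (hY : ∀ p ∈ Y, ∀ q ∈ Y, p ≠ q → δ ≤ dist p q) (y : E3) :
    ∀ p ∈ (fun z => z - y) '' Y, ∀ q ∈ (fun z => z - y) '' Y, p ≠ q → δ ≤ dist p q := by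
  rintro p ⟨p', hp', rfl⟩ q ⟨q', hq', rfl⟩ hpq
  have hne : p' ≠ q' := fun h => hpq (by rw [h])
  have := hY p' hp' q' hq' hne
  rwa [dist_sub_right]

/-- `‖a‖ ≤ ‖b‖ + dist a b`. [folklore] -/
theorem norm_le_norm_add_dist' (a b : E3) : ‖a‖ ≤ ‖b‖ + dist a b := by
  rw [dist_eq_norm]; exact norm_le_insert' a b

/-- **`stub_localLimit` of line `c-layer-witness-strictness`, verbatim, sorry-free.** [cite: BaakeGrimm2013, Rem. 5.6] -/
theorem stub_localLimit_proof :
    ∀ (P : PeriodicConfiguration 3) (ρ' R ε : ℝ) (U : ℝ → ℝ) (F : Set E3 → ℝ) (S : ℕ → Set E3),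
      0 < ε →
      (∀ r : ℝ, 0 < r → 0 ≤ U r) → ContinuousOn U (Set.Ioi 0) → (∀ T : Set E3, 0 ≤ F T) →
      (∀ ε' : ℝ, 0 < ε' → ∃ η : ℝ, 0 < η ∧ ∀ S' T : Set E3,
        (∀ p ∈ S', ∀ q ∈ S', p ≠ q → (1 / 3 : ℝ) ≤ dist p q) →
        (∀ p ∈ T, ∀ q ∈ T, p ≠ q → (1 / 3 : ℝ) ≤ dist p q) →
        (0 : E3) ∈ S' → (0 : E3) ∈ T → BallMatch η (ρ' + 1) 0 S' T →
        |F (S' ∩ Metric.closedBall 0 ρ') - F (T ∩ Metric.closedBall 0 ρ')| ≤ ε') →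
      (∀ k, ∀ p ∈ S k, ∀ q ∈ S k, p ≠ q → (1 / 3 : ℝ) ≤ dist p q) →
      (∀ k, (0 : E3) ∈ S k) →
      (∀ k, ¬ ∃ A : E3 →ₗᵢ[ℝ] E3,
        (∀ p ∈ P.points, ‖p‖ ≤ R → ∃ q ∈ S k, dist q (A p) ≤ ε) ∧
        (∀ q ∈ S k, ‖q‖ ≤ R → ∃ p ∈ P.points, dist q (A p) ≤ ε)) →
      (∀ L η : ℝ, 0 < η → ∀ᶠ k in Filter.atTop, ∀ s ∈ S k, ‖s‖ ≤ L →
        F (((fun z => z - s) '' S k) ∩ Metric.closedBall 0 ρ') ≤ η ∧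
        ∀ s' ∈ S k, s' ≠ s → ‖s'‖ ≤ L → U (dist s s') ≤ η) →
      ∃ Y : Set E3,
        (∀ p ∈ Y, ∀ q ∈ Y, p ≠ q → (1 / 3 : ℝ) ≤ dist p q) ∧ (0 : E3) ∈ Y ∧
        (∀ y ∈ Y, F (((fun z => z - y) '' Y) ∩ Metric.closedBall 0 ρ') = 0) ∧
        (∀ y ∈ Y, ∀ y' ∈ Y, y ≠ y' → U (dist y y') = 0) ∧
        ¬ ∃ A : E3 →ₗᵢ[ℝ] E3,
          (∀ p ∈ P.points, ‖p‖ ≤ R + 1 → ∃ q ∈ Y, dist q (A p) ≤ ε / 2) ∧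
          (∀ q ∈ Y, ‖q‖ ≤ R + 1 → ∃ p ∈ P.points, dist q (A p) ≤ ε / 2) := by
  intro P ρ' R ε U F S hε hU0 hUc hF0 hFc hsep h0 hbad hsmall
  -- (1) sequential compactness in the local matching topology
  obtain ⟨φ, Y, hφ, hYsep, hlim⟩ :=
    exists_subseq_forall_eventually_ballMatch (δ := 1 / 3) (by norm_num) S hsep
  have hsmallφ : ∀ L η : ℝ, 0 < η → ∀ᶠ k in atTop, ∀ s ∈ S (φ k), ‖s‖ ≤ L →
      F (((fun z => z - s) '' S (φ k)) ∩ closedBall 0 ρ') ≤ η ∧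
      ∀ s' ∈ S (φ k), s' ≠ s → ‖s'‖ ≤ L → U (dist s s') ≤ η :=
    fun L η hη => hφ.tendsto_atTop.eventually (hsmall L η hη)
  -- (2) the root survives: `0 ∈ Y`
  have hnear : ∀ η : ℝ, 0 < η → ∃ y ∈ Y, ‖y‖ ≤ η := by
    intro η hη
    obtain ⟨k, hk⟩ := (hlim 0 η hη).exists
    obtain ⟨y, hy, hd⟩ := hk.2 0 (h0 (φ k)) (by simp)
    exact ⟨y, hy, by rwa [dist_comm, dist_zero_right] at hd⟩
  have hY0 : (0 : E3) ∈ Y := by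
    obtain ⟨y₀, hy₀, hn₀⟩ := hnear (1 / 7) (by norm_num)
    suffices h : y₀ = 0 by rwa [h] at hy₀
    by_contra hne
    have hpos : 0 < ‖y₀‖ := norm_pos_iff.2 hne
    obtain ⟨y₁, hy₁, hn₁⟩ := hnear (‖y₀‖ / 2) (half_pos hpos)
    by_cases h01 : y₀ = y₁
    · subst h01; linarith
    · have h1 := hYsep y₀ hy₀ y₁ hy₁ h01
      have h2 : dist y₀ y₁ ≤ ‖y₀‖ + ‖y₁‖ := dist_le_norm_add_norm _ _
      linarith
  -- (3) pair distances of `Y` are zeros of `U`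
  have hYU : ∀ y ∈ Y, ∀ y' ∈ Y, y ≠ y' → U (dist y y') = 0 := by
    intro y hy y' hy' hne
    have hdpos : 0 < dist y y' := dist_pos.2 hne
    by_contra hUne
    have hc : 0 < U (dist y y') := lt_of_le_of_ne (hU0 _ hdpos) (Ne.symm hUne)
    have hcont := hUc (dist y y') hdpos
    rw [Metric.continuousWithinAt_iff] at hcont
    obtain ⟨δ, hδ, hδU⟩ := hcont (U (dist y y') / 2) (half_pos hc)
    set η : ℝ := min (min (δ / 4) (dist y y' / 4)) (U (dist y y') / 4) with hηdef
    have hη : 0 < η := by positivity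
    have hηδ : η ≤ δ / 4 := (min_le_left _ _).trans (min_le_left _ _)
    have hηd : η ≤ dist y y' / 4 := (min_le_left _ _).trans (min_le_right _ _)
    have hηc : η ≤ U (dist y y') / 4 := min_le_right _ _
    set L : ℝ := max ‖y‖ ‖y'‖ + η with hLdef
    obtain ⟨k, hBM, hsm⟩ := ((hlim L η hη).and (hsmallφ L η hη)).exists
    have hyL : dist y 0 ≤ L := by
      rw [dist_zero_right]; exact (le_max_left _ _).trans (le_add_of_nonneg_right hη.le)
    have hy'L : dist y' 0 ≤ L := by
      rw [dist_zero_right]; exact (le_max_right _ _).trans (le_add_of_nonneg_right hη.le)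
    obtain ⟨s, hs, hsy⟩ := hBM.1 y hy hyL
    obtain ⟨s', hs', hs'y'⟩ := hBM.1 y' hy' hy'L
    have hss' : s ≠ s' := by
      intro e
      rw [e] at hsy
      have := dist_triangle_left y y' s'
      linarith
    have hsn : ‖s‖ ≤ L := by
      have := norm_le_norm_add_dist' s y
      have hyn : ‖y‖ ≤ max ‖y‖ ‖y'‖ := le_max_left _ _
      linarith
    have hs'n : ‖s'‖ ≤ L := by
      have := norm_le_norm_add_dist' s' y'
      have hyn : ‖y'‖ ≤ max ‖y‖ ‖y'‖ := le_max_right _ _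
      linarith
    obtain ⟨-, hUk⟩ := hsm s hs hsn
    have hle : U (dist s s') ≤ η := hUk s' hs' (Ne.symm hss') hs'n
    have hsspos : 0 < dist s s' := dist_pos.2 hss'
    have hclose : dist (dist s s') (dist y y') < δ := by
      have := dist_dist_dist_le s s' y y'
      linarith
    have hUclose := hδU hsspos hclose
    rw [Real.dist_eq, abs_lt] at hUclose
    linarith [hUclose.1]
  -- (4) every recentred `ρ'`-star of `Y` is `F`-tight
  have hYF : ∀ y ∈ Y, F (((fun z => z - y) '' Y) ∩ closedBall 0 ρ') = 0 := by
    intro y hy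
    by_contra hne
    have hc : 0 < F (((fun z => z - y) '' Y) ∩ closedBall 0 ρ') := lt_of_le_of_ne (hF0 _) (Ne.symm hne)
    set c := F (((fun z => z - y) '' Y) ∩ closedBall 0 ρ') with hcdef
    obtain ⟨η₀, hη₀, hcontF⟩ := hFc (c / 2) (half_pos hc)
    set η : ℝ := min (min (η₀ / 2) 1) (c / 4) with hηdef
    have hη : 0 < η := by positivity
    have hη₀' : η ≤ η₀ / 2 := (min_le_left _ _).trans (min_le_left _ _)
    have hη1 : η ≤ 1 := (min_le_left _ _).trans (min_le_right _ _)
    set L' : ℝ := ‖y‖ + |ρ'| + 3 with hL'def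
    obtain ⟨k, hBM, hsm⟩ :=
      ((hlim L' η hη).and (hsmallφ (‖y‖ + 1) (c / 4) (by positivity))).exists
    have hyL' : dist y 0 ≤ L' := by
      rw [dist_zero_right]; linarith [abs_nonneg ρ']
    obtain ⟨s, hs, hsy⟩ := hBM.1 y hy hyL'
    have hsn : ‖s‖ ≤ ‖y‖ + 1 := by
      have := norm_le_norm_add_dist' s y
      linarith
    obtain ⟨hFs, -⟩ := hsm s hs hsn
    have hS'sep := sep_translate (hsep (φ k)) s
    have hTsep := sep_translate hYsep y
    have h0S' : (0 : E3) ∈ (fun z => z - s) '' S (φ k) := ⟨s, hs, sub_self s⟩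
    have h0T : (0 : E3) ∈ (fun z => z - y) '' Y := ⟨y, hy, sub_self y⟩
    have hρ : ρ' ≤ |ρ'| := le_abs_self ρ'
    have hBM' : BallMatch η₀ (ρ' + 1) 0 ((fun z => z - s) '' S (φ k)) ((fun z => z - y) '' Y) := by
      constructor
      · rintro _ ⟨y₁, hy₁, rfl⟩ hn
        rw [dist_zero_right, ← dist_eq_norm] at hn
        have hy₁n : dist y₁ 0 ≤ L' := by
          rw [dist_zero_right]
          have := norm_le_norm_add_dist' y₁ y
          linarith
        obtain ⟨a₁, ha₁, hd₁⟩ := hBM.1 y₁ hy₁ hy₁n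
        refine ⟨a₁ - s, ⟨a₁, ha₁, rfl⟩, ?_⟩
        calc dist (a₁ - s) (y₁ - y) ≤ dist a₁ y₁ + dist s y := dist_sub_sub_le _ _ _ _
          _ ≤ η₀ := by linarith
      · rintro _ ⟨a₁, ha₁, rfl⟩ hn
        rw [dist_zero_right, ← dist_eq_norm] at hn
        have ha₁n : dist a₁ 0 ≤ L' := by
          rw [dist_zero_right]
          have := norm_le_norm_add_dist' a₁ s
          linarith
        obtain ⟨y₁, hy₁, hd₁⟩ := hBM.2 a₁ ha₁ ha₁n
        refine ⟨y₁ - y, ⟨y₁, hy₁, rfl⟩, ?_⟩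
        calc dist (a₁ - s) (y₁ - y) ≤ dist a₁ y₁ + dist s y := dist_sub_sub_le _ _ _ _
          _ ≤ η₀ := by linarith
    have key := hcontF _ _ hS'sep hTsep h0S' h0T hBM'
    rw [abs_le] at key
    linarith [key.1, key.2]
  -- (5) `Y` is not root-matched at `(R + 1, ε / 2)`
  refine ⟨Y, hYsep, hY0, hYF, hYU, ?_⟩
  rintro ⟨A, hA1, hA2⟩
  set η : ℝ := min (ε / 2) 1 with hηdef
  have hη : 0 < η := by positivity
  have hηε : η ≤ ε / 2 := min_le_left _ _
  have hη1 : η ≤ 1 := min_le_right _ _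
  set R' : ℝ := |R| + ε / 2 + 2 with hR'def
  obtain ⟨k, hBM⟩ := (hlim R' η hη).exists
  have hRabs : R ≤ |R| := le_abs_self R
  apply hbad (φ k)
  refine ⟨A, ?_, ?_⟩
  · intro p hp hpn
    obtain ⟨q, hq, hqd⟩ := hA1 p hp (by linarith)
    have hqn : dist q 0 ≤ R' := by
      rw [dist_zero_right]
      have h1 := norm_le_norm_add_dist' q (A p)
      rw [A.norm_map] at h1
      linarith
    obtain ⟨a, ha, had⟩ := hBM.1 q hq hqn
    refine ⟨a, ha, ?_⟩
    calc dist a (A p) ≤ dist a q + dist q (A p) := dist_triangle _ _ _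
      _ ≤ ε := by linarith
  · intro a ha han
    have han' : dist a 0 ≤ R' := by rw [dist_zero_right]; linarith
    obtain ⟨q, hq, hqd⟩ := hBM.2 a ha han'
    have hqn : ‖q‖ ≤ R + 1 := by
      have h1 := norm_le_norm_add_dist' q a
      rw [dist_comm] at h1
      linarith
    obtain ⟨p, hp, hpd⟩ := hA2 q hq hqn
    refine ⟨p, hp, ?_⟩
    calc dist a (A p) ≤ dist a q + dist q (A p) := dist_triangle _ _ _
      _ ≤ ε := by linarith

end Summit.AtomisticToContinuum.Crystallization.Cruxes.SlackRigidity.DrefuteEvidence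

end
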